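import Mathlib
import Summits.ValiantsHypothesis.ValiantsHypothesis.Theorems.GrenetZeonTwoDimCoefficientsAfterCodimTwo
import Summits.ValiantsHypothesis.ValiantsHypothesis.Theorems.GrenetZeonTwoDimCoefficientsDualUnipotentFlat
import Summits.ValiantsHypothesis.ValiantsHypothesis.Theorems.GrenetZeonTwoDimCoefficientsDualUnipotentWildCoreRung

/-!
# Crux `GrenetZeon.TwoDimCoefficients` (stmt-ValiantsHypothesis-8062): the state of the art IN THE CRUX'S
# OWN CURRENCY — every `(m, ≤ 2)`-representation of `per_n` has `m + 2 ≥ √2·n`; conditional rung past `√2`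

The crux reads `∃ C n₀, ∀ n ≥ n₀, ∀ m, HasDim2Repr n m → n² ≤ C·m` (`twoDimCoefficients_iff`, `Iff.rfl`), where
`HasDim2Repr n m` (✓ `…TwoDimCoefficientsDefs`) is VERBATIM the hypothesis of the route declaration: an affine
`m × m` matrix over `R[x]`, `R` a commutative `ℂ`-algebra of dimension `≤ 2`, whose determinant carries the
coefficients of `per_n` under a linear functional.  The tree holds, unconditionally,

* the DISJUNCTIVE form ✓ `hasDim2Repr_sq_le_or_unipotent_all` (`n² ≤ C·m` unless the representation is
  unipotent-dual — Hessian point of stmt-8061 + unit dichotomy + split/dual jet counts), and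
* the LINEAR form ✓ `hasDim2Repr_linearBound` / `le_of_hasDim2Repr` (`n ≤ m`),

but the best inequality valid for EVERY `(m, ≤ 2)`-representation was typed only on the unipotent branch
(✓ `two_mul_sq_le_of_dualUnipotentRepr`: `2n² ≤ m² + 4n`).  This file folds the branches:

* ★ `hasDim2Repr_two_mul_sq_le_all` — UNCONDITIONAL: `∃ n₀, ∀ n ≥ n₀, ∀ m, HasDim2Repr n m → 2n² ≤ (m+2)²`.
  Two-dimensional coefficients buy at most the factor between Mignon–Ressayre's `m ≥ n²/2` (dimension `1`) and
  `m ≥ √2·n − 2`; the crux asks for `m ≥ n²/C`.  This is the honest one-line status of the ASIDE item 8062.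
* `hasDim2Repr_rung_of_irreducible_dim_bound` — CONDITIONAL: if irreducible nilpotent subspaces of `M_s(ℂ)`
  (`s ≥ s₁`) have `c·dim ≤ a·s² + e·s` with `2a < c` (hypothesis SHAPE; the Mathes–Omladič–Radjavi 1991 §5
  question, OPEN — not a fact of the literature), then `∃ n₀, ∀ n ≥ n₀, ∀ m, HasDim2Repr n m →
  (64c+1)·n² ≤ 32c·m²` (✓ `exists_rung_of_irreducible_dim_bound` on the unipotent branch; the other branch is
  linear in `m`).

HONEST FRAMING: a fold of existing branches plus a conditional rung; 8062 is an ASIDE item of route GrenetZeon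
(constant-factor statements inside the Mignon–Ressayre regime); no stub, crux, rung or `VP ≠ VNP` is proved.
No definitions, no named facts.

References: T. Mignon, N. Ressayre, Int. Math. Res. Not. 2004:79, Thm. 1.1; M. Gerstenhaber, Amer. J. Math. 80
(1958), Thm. 1; B. Mathes, M. Omladič, H. Radjavi, Linear Algebra Appl. 149 (1991) 215–225, §5.
-/

-- single-conjunct layout `Summits/ValiantsHypothesis/ValiantsHypothesis`: the duplicated namespace
-- component is mandated by the tree.
set_option linter.dupNamespace false
set_option autoImplicit false

noncomputable section

namespace Summit.ValiantsHypothesis.ValiantsHypothesis.Cruxes.TwoDimCoefficients.DimTwoCases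

open Matrix

/-- ★ **`√2·n` for every `(m, ≤ 2)`-representation of the permanent (unconditional).**  There is `n₀` such that
for all `n ≥ n₀` and all `m`, `HasDim2Repr n m → 2n² ≤ (m + 2)²`.  Proof: by ✓ `hasDim2Repr_sq_le_or_unipotent_all`
either `n² ≤ C·m` — and `m ≥ n ≥ 2C` (✓ `le_of_hasDim2Repr`) gives `2Cm ≤ m²` — or the representation is
unipotent-dual and ✓ `two_mul_sq_le_of_dualUnipotentRepr` gives `2n² ≤ m² + 4n ≤ m² + 4m`.
[cite: MignonRessayre2004, Thm. 1.1 — via the tree; folklore fold] -/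
theorem hasDim2Repr_two_mul_sq_le_all :
    ∃ n₀ : ℕ, ∀ n ≥ n₀, ∀ m : ℕ, HasDim2Repr n m → 2 * n ^ 2 ≤ (m + 2) ^ 2 := by
  obtain ⟨C, n₀, hC⟩ := hasDim2Repr_sq_le_or_unipotent_all
  refine ⟨max n₀ (2 * C), fun n hn m h => ?_⟩
  have hnm : n ≤ m := le_of_hasDim2Repr h
  rcases hC n (le_trans (le_max_left _ _) hn) m h with h1 | h2
  · have hmC : 2 * C ≤ m := le_trans (le_trans (le_max_right _ _) hn) hnm
    have p : 2 * C * m ≤ m * m := Nat.mul_le_mul_right m hmC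
    nlinarith [h1, p]
  · have h3 := two_mul_sq_le_of_dualUnipotentRepr h2
    nlinarith [h3, hnm]

/-- **Conditional rung past `√2·n` in the crux's currency.**  If every irreducible nilpotent linear subspace
`V ⊆ M_s(ℂ)` with `s ≥ s₁` has `c·dim V ≤ a·s² + e·s` for constants with `2a < c` (hypothesis SHAPE — the
Mathes–Omladič–Radjavi question, OPEN), then there is `n₀` with: for all `n ≥ n₀` and all `m`,
`HasDim2Repr n m → (64c + 1)·n² ≤ 32c·m²`, i.e. `m ≥ √(2 + 1/(32c))·n`.  (Unipotent branch: ✓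
`exists_rung_of_irreducible_dim_bound`; the other branch of ✓ `hasDim2Repr_sq_le_or_unipotent_all` is linear.)
[folklore; the dimension hypothesis is NOT a fact of the literature] -/
theorem hasDim2Repr_rung_of_irreducible_dim_bound (a c e s₁ : ℕ) (h2a : 2 * a < c)
    (hIRR : ∀ s : ℕ, s₁ ≤ s → ∀ V : Submodule ℂ (Matrix (Fin s) (Fin s) ℂ), (∀ B ∈ V, IsNilpotent B) →
      (∀ U : Submodule ℂ (Fin s → ℂ), (∀ B ∈ V, ∀ x ∈ U, B *ᵥ x ∈ U) → U = ⊥ ∨ U = ⊤) →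
      c * Module.finrank ℂ V ≤ a * s ^ 2 + e * s) :
    ∃ n₀ : ℕ, ∀ n ≥ n₀, ∀ m : ℕ, HasDim2Repr n m → (64 * c + 1) * n ^ 2 ≤ 32 * c * m ^ 2 := by
  obtain ⟨C, n₀, hC⟩ := hasDim2Repr_sq_le_or_unipotent_all
  obtain ⟨n₁, hn₁⟩ := exists_rung_of_irreducible_dim_bound a c e s₁ h2a hIRR
  refine ⟨max (max n₀ n₁) (3 * C), fun n hn m h => ?_⟩
  have hnm : n ≤ m := le_of_hasDim2Repr h
  have hn₀ : n₀ ≤ n := le_trans (le_trans (le_max_left _ _) (le_max_left _ _)) hn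
  have hn₁' : n₁ ≤ n := le_trans (le_trans (le_max_right _ _) (le_max_left _ _)) hn
  rcases hC n hn₀ m h with h1 | h2
  · have hmC : 3 * C ≤ m := le_trans (le_trans (le_max_right _ _) hn) hnm
    have hc1 : 1 ≤ 32 * c := by omega
    have q1 : (64 * c + 1) * n ^ 2 ≤ (64 * c + 1) * (C * m) := Nat.mul_le_mul_left _ h1
    have q2 : 32 * c * m * (3 * C) ≤ 32 * c * m * m := Nat.mul_le_mul_left _ hmC
    have q3 : 1 * (C * m) ≤ 32 * c * (C * m) := Nat.mul_le_mul_right _ hc1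
    nlinarith [q1, q2, q3]
  · exact hn₁ n hn₁' m h2

end Summit.ValiantsHypothesis.ValiantsHypothesis.Cruxes.TwoDimCoefficients.DimTwoCases

end
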